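import Summits.KontsevichZagierPeriods.KontsevichZagierPeriods.Theses.GammaCornerAnomaly

/-!
# `LegendreLogWronskian` (stmt-KontsevichZagierPeriods-8977, route GammaCornerAnomaly, rank 3) — birth skeleton

Crux (weight-2 MUM identity of the Legendre pencil): for every rational `λ₀ ∈ (0,1)` the pinned
3-dimensional representation `[(0,1)³, G_{λ₀}]`,
`G_λ(x,t,s) = (1−λ)κ_λ(t)κ_λ(s) − 2λ(1−λ)(j_λ(x,t)κ⁽¹⁾_λ(s) − (∂_λ j_λ)(x,t)κ_λ(s))`
(value `D(λ₀) = (1−λ₀)K² − 2λ₀(1−λ₀)(J K_λ − J_λ K)`), is `KZ.Equivalent` to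
`[(0,1)³, 4/((1+t²)(1+s²))]` (value `π²/4`). In the route file the crux is
`let LW : ℚ → Prop := …; ∀ l : ℚ, 0 < l → l < 1 → LW l`.

Line `birth` = the route's own foreseen glued split of this node (route header, TWO-LAYER PLAN:
"LegendreLogWronskian ⇐ LogWronskianTransport (λ₀ = 0) → LogWronskianAnchor"), i.e. ANCHOR AT THE MUM
CORNER + GAUSS–MANIN TRANSPORT of the conserved quantity `D`, both already filed as typed support items of
the route over the SAME `let LW` family, so the two stubs are those items BY NAME (closing either stub
closes a ledger item; closing both closes this crux through `LegendreLogWronskian_of_stubs`):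

* `stub_anchor` = item stmt-KontsevichZagierPeriods-8979 `LogWronskianAnchor` (`LW 0`): at the MUM fibre
  the family degenerates to `κ₀(t)κ₀(s) = (t(1−t))^{−1/2}(s(1−s))^{−1/2}/4` (the `2λ(1−λ)(…)` term carries
  the factor `λ = 0`), and `[(0,1)³, κ₀κ₀] ∼ [(0,1)³, 4/((1+t²)(1+s²))]`, i.e. `K(0)² = (π/2)²`, is ONE
  rule-2 move: the product change of variables `(x,u,v) ↦ (x, 4u²/(1+u²)², 4v²/(1+v²)²)` of the open cube
  onto itself (`t = sin²(2 arctan u)`, `dt/(2√(t(1−t))) = 2du/(1+u²)`, injective since `2u/(1+u²)` is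
  increasing on `(0,1)`; the dummy `x` rides along), after one integrand-additivity move discarding the
  zero term. Size M (rule-2 side conditions in dimension 3: `HasFDerivWithinAt`, `det`, semialgebraic
  graph). Provable now.
* `stub_transport` = item stmt-KontsevichZagierPeriods-8978 `LogWronskianTransport`
  (`∀ l₀ l₁ : ℚ, 0 ≤ l₀ → l₀ < 1 → 0 < l₁ → l₁ < 1 → LW l₀ → LW l₁`): flat transport of the pinned
  `D`-representation in the modulus, INCLUDING from the corner `l₀ = 0`. The METHOD (route header): one
  Newton–Leibniz move in `λ` on the band `(0,1)³ × [λ₀, λ₁]` with primitive the family `G` itself,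
  integrand additivity, and a creative-telescoping certificate `∂_λ G = ∂ₓX + ∂ₜT + ∂ₛS` with
  `ℚ`-semialgebraic potentials, discharged by box-Stokes moves. The tree already holds this engine,
  PROVED, in the exact typed shape needed (`n = 3`, parameter last, `t₀ = λ₀`, `t₁ = λ₁` algebraic):
  `Summit.KontsevichZagierPeriods.KontsevichZagierPeriods.CompleteModGammaSectorEngine.stub_certificateTransport`
  (band form; `…stub_divergenceCertificateTransport` closed-box form; reduction
  `certificateTransport_of_stokesBoxBand` + `stub_stokesBoxBand` / `stub_kzStokesBox` =
  `GaussManinCertificates.KZStokesBox_proof`), used there to transport Legendre's relation (weight 0,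
  `stub_legendreModulusPropagation`). Its hypotheses want potentials VANISHING on the faces
  `xᵢ ∈ {0,1}`; the route header (TWO-LAYER PLAN) expects instead that "the x-direction boundary terms are
  the lower-dimensional K-type reps that cancel" — consistent with `J` solving an INHOMOGENEOUS Legendre
  equation, `L(2J) = K − 2(1−λ)K_λ` for `L = λ(1−λ)∂_λ² + (1−2λ)∂_λ − ¼`, `K_λ = dK/dλ` (from `L K = 0`,
  `L(K log λ) = 2(1−λ)K_λ − K` and the weight-1 identity `πK′ + K log λ − K log 16 + 2J = 0`) — in which
  case the engine must be run with explicit face representations (rule 3 with non-zero boundary values, the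
  2-dimensional cancellation in `(t,s)` as its own chain): the lead's first design decision, and the risk
  named on the item (why it might fail: the face terms must converge and cancel exactly, down to `λ₀ = 0`). The
  transport is logically implied by the crux (its consequent ranges over all `λ₁ ∈ (0,1)`): it is the
  method, not a separate obstruction (route header, rev 3). Size L/XL; load-bearing.

Composition (sorry-free, pure logic over the shared `let LW` family, definitional unfolding only):
`LegendreLogWronskian_of : LogWronskianAnchor → LogWronskianTransport → LegendreLogWronskian`,
`fun hA hT l hl hl' => hT 0 l le_rfl zero_lt_one hl hl' hA`; `LegendreLogWronskian_of_stubs` feeds the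
two stubs in by name (the theorem `#h21_check_skeleton` keys on concludes the crux BY NAME).

Disproof used: none relevant — no `Cruxes/LegendreLogWronskian/Disproof.lean`, no `Lines/*`, no crux
ideas exist at registration (`ledger crux ls stmt-KontsevichZagierPeriods-8977`: no workfiles); no
`_false_without_` theorem and no landed `Theorems/LegendreLogWronskian/Negative/*`; the summit's
negatives index has one unrelated entry (KinematicFormulas plane convexity, stmt-5394). Values: the typed
`G_λ` integrates to `π²/4` to `6e−14` at `λ ∈ {1/3, 1/2}` and `D(λ) − π²/4 ≤ 3.3e−11` at
`λ ∈ {0.05, 0.2, 1/3, 0.5, 0.9}` (refuter evidence `legendre_numerics.md`, `num_legendre.py` on the item);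
`D(0) = K(0)² = π²/4` exactly.
-/

noncomputable section

set_option linter.dupNamespace false

namespace Summit.KontsevichZagierPeriods.KontsevichZagierPeriods.Cruxes.LegendreLogWronskian.Birth

open Summit.KontsevichZagierPeriods.KontsevichZagierPeriods.Theses.GammaCornerAnomaly
  (LegendreLogWronskian LogWronskianAnchor LogWronskianTransport)

/-! ## Registered stubs (the only `sorry`s of this file) -/

/-- **Stub 1 — ANCHOR AT THE MUM FIBRE** = route item stmt-KontsevichZagierPeriods-8979
`LogWronskianAnchor`, by name: `LW 0`, i.e. every representation pinned to `[(0,1)³, G₀]`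
(`G₀ = κ₀(t)κ₀(s) − 0`, `κ₀(t) = (t(1−t))^{−1/2}/2`) is `KZ.Equivalent` to every representation pinned to
`[(0,1)³, 4/((1+t²)(1+s²))]` (`K(0)² = (π/2)²`). One integrand-additivity move (drop the term with the
factor `λ = 0`) and one rule-2 move `(x,u,v) ↦ (x, 4u²/(1+u²)², 4v²/(1+v²)²)` of the open cube onto
itself (Jacobian `∏ 8u(1−u²)/(1+u²)³`, and `κ₀(4u²/(1+u²)²)·8u(1−u²)/(1+u²)³ = 2/(1+u²)`).
Why it might fail: only Lean-side (rule-2 side conditions in dimension 3). Size M; provable now.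
[cite: KontsevichZagier2001, §1.2 rule (2)] -/
theorem stub_anchor : LogWronskianAnchor := by
  sorry

/-- **Stub 2 — GAUSS–MANIN TRANSPORT OF THE CONSERVED QUANTITY `D`** = route item
stmt-KontsevichZagierPeriods-8978 `LogWronskianTransport`, by name: for rational `λ₀ ∈ [0,1)` and
`λ₁ ∈ (0,1)`, `LW λ₀ → LW λ₁` (the pinned `D`-representation at `λ₀` equivalent to the arctan-square
representation implies the same at `λ₁`), INCLUDING from the corner `λ₀ = 0`, where every piece of `G_λ`
is an invariant-cycle kernel, continuous and `L¹`-tame. Method: one Newton–Leibniz move in `λ` on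
`(0,1)³ × [λ₀,λ₁]` (primitive = the family `G` itself), integrand additivity, a creative-telescoping
certificate `∂_λ G = ∂ₓX + ∂ₜT + ∂ₛS` with `ℚ`-semialgebraic potentials, box-Stokes moves — the landed
engine `CompleteModGammaSectorEngine.stub_certificateTransport` (`n = 3`) when the potentials vanish on
the faces; with explicit face representations otherwise. Why it might fail (the item's): certificates are
rational only off the branch divisor, and the face terms (`κ_λ ~ (1−t)^{−1/2}(1−λt)^{−1/2}`, `κ⁽¹⁾`
carries `(1−λs)^{−3/2}`) must converge and cancel exactly for every `λ` down to the corner. Size L/XL;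
load-bearing (logically implied by the crux: it is the method).
[cite: KontsevichZagier2001, §1.2 rules (1) and (3)] -/
theorem stub_transport : LogWronskianTransport := by
  sorry

/-! ## Composition: the crux by name (sorry-free) -/

/-- **The skeleton theorem** — ANCHOR → TRANSPORT → `LegendreLogWronskian` BY NAME: for rational
`l ∈ (0,1)`, transport from `l₀ = 0` (`le_rfl`, `zero_lt_one`) to `l₁ = l` applied to the anchor `LW 0`.
The three route decls share the `let LW` family verbatim, so this is definitional unfolding and modus
ponens. [cite: KontsevichZagier2001, §1.2] -/
theorem LegendreLogWronskian_of : LogWronskianAnchor → LogWronskianTransport → LegendreLogWronskian := by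
  intro hA hT l hl hl'
  exact hT 0 l le_rfl zero_lt_one hl hl' hA

/-- The crux from the registered stubs themselves (so that closing `stub_anchor` and `stub_transport`,
i.e. items 8979 and 8978, closes item 8977 by this file). [cite: KontsevichZagier2001, §1.2] -/
theorem LegendreLogWronskian_of_stubs : LegendreLogWronskian :=
  LegendreLogWronskian_of stub_anchor stub_transport

end Summit.KontsevichZagierPeriods.KontsevichZagierPeriods.Cruxes.LegendreLogWronskian.Birth

end
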